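import Summits.QuantumFields.YangMills.Theorems.AtomicSynthesisSlotSynthFlatten

/-!
# AtomicSynthesis (stmt-QuantumFields-28126), stub `stub_singleSlot` — the H4 split: `stub_singleSlot ⟸ MolliApprox b 6 ∧ RiemannDisc b 6`

AUTHOR: planner ym-idea-11 g14 (HOME `g14/oneStepSplit.lean` §H4 split, sorry-free); landed by prover w4 g22 (`--supports 28126`; also
path α of 23138 / 22956).  One round `OneStep b 6 θ C R` is assembled from H4a `MolliApprox b 6` (the moment-killed mollifier
reproduces `f` up to `C₁(τ/σ)⁶A/τ^m` in `D^m`, `m ≤ 6`) and H4b `RiemannDisc b 6` (Riemann-sum discretisation of the smoothing on mesh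
`τ/m₀`: error `(C₂/m₀)A/τ^m`, mass `C₂(ϱ/τ)⁴A`, centres within `ϱ + R₂τ`), with `θ = min(1/2, 1/(2(C₁+1)))`,
`m₀ = ⌈2(C₂+1)/θ⁵⌉₊ + 1` (`oneStepExists6_of_split`); with H1 (`momentKilling`, `AtomicSynthesisMomentKilling`) and H5
(`stubSingleSlot_of_oneStepExists`, `AtomicSynthesisSlotSynthFlatten`): `stubSingleSlot_of_split`.  `MomentKilling` is the H1
file's (duplicate dropped).  HONEST: H4a/H4b are NOT proved here; nothing touches Yang–Mills; the YM mass gap is NOT proved. [folklore]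
-/

set_option autoImplicit false

noncomputable section

open scoped BigOperators Topology ContDiff
open MeasureTheory Filter Metric
open Summit.QuantumFields.YangMills.Theorems.RPOnsetFloorPosTimeSynthCollar (SlotSynth)

namespace Summit.QuantumFields.YangMills.Cruxes.AtomicSynthesis.SingleSlotPlan

/-! ## H4 split: `OneStepExists 6` from H4a (mollification with vanishing moments) and H4b (Riemann-sum discretisation)

Both pieces are stated for the profile `b` and a finite-combination kernel `v ↦ Σ_j w_j b(v − u_j)`; the composition below is
sorry-free, so the registered stub `stub_singleSlot` is kernel-reduced to `MolliApprox b 6 ∧ RiemannDisc b 6` (given H1, proved in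
`momentWeights.lean`).  HONEST: H4a/H4b are the analysis (each M); nothing here touches Yang–Mills. -/

/-- Smoothing against the scaled kernel: `x ↦ ∫ τ⁻⁴ K(τ⁻¹(x − y)) f(y) dy`. -/
def kSmooth (K : E4 → ℝ) (τ : ℝ) (f : E4 → ℝ) (x : E4) : ℝ :=
  ∫ y, (τ ^ 4)⁻¹ * K (τ⁻¹ • (x - y)) * f y

/-- The finite-combination kernel `v ↦ Σ_j w_j b(v − u_j)`. -/
def combKernel (b : SchwartzMap E4 ℝ) {J₀ : ℕ} (w : Fin J₀ → ℝ) (u : Fin J₀ → E4) (v : E4) : ℝ :=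
  ∑ j, w j * b (v - u j)

/-- **H4a** (mollification with vanishing moments; M).  For a normalised finite-combination kernel with vanishing moments of
orders `1 … N−1`, smoothing at scale `τ ≤ σ` reproduces a `C^N`-controlled `f` up to `C₁ (τ/σ)^N · A/τ^m` in the `m`-th derivative
(`m ≤ N`; Taylor remainder of order `N − m` on `D^m f` against the moments; at `m = N` just `2‖K‖₁`).  Stated for compactly
supported `b` (guard inside). [folklore] -/
def MolliApprox (b : SchwartzMap E4 ℝ) (N : ℕ) : Prop :=
  HasCompactSupport (b : E4 → ℝ) → ∀ (J₀ : ℕ) (w : Fin J₀ → ℝ) (u : Fin J₀ → E4),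
    (∫ y, combKernel b w u y) = 1 →
    (∀ α : Fin 4 → ℕ, 1 ≤ ∑ i, α i → ∑ i, α i < N → ∫ y, combKernel b w u y * ∏ i, (y i) ^ (α i) = 0) →
    ∃ C₁ : ℝ, 0 ≤ C₁ ∧
      ∀ (f : E4 → ℝ) (c : E4) (ϱ σ A τ : ℝ), ContDiff ℝ ∞ f → 0 < τ → τ ≤ σ → σ ≤ ϱ → 0 ≤ A →
        tsupport f ⊆ closedBall c ϱ →
        (∀ m : ℕ, m ≤ N → ∀ z, ‖iteratedFDeriv ℝ m f z‖ ≤ A / σ ^ m) →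
        ContDiff ℝ ∞ (kSmooth (combKernel b w u) τ f) ∧
        ∀ m : ℕ, m ≤ N → ∀ z,
          ‖iteratedFDeriv ℝ m (fun x => f x - kSmooth (combKernel b w u) τ f x) z‖ ≤ C₁ * (τ / σ) ^ N * A / τ ^ m

/-- **H4b** (Riemann-sum discretisation; M).  The smoothing of `f` against the scaled finite-combination kernel is, for every
oversampling `m₀ ≥ 1` (mesh `τ/m₀`), within `(C₂/m₀) · A/τ^m` in the `m`-th derivative (`m ≤ N`) of a finite combination of
translates of `b` at scale `τ`, with mass `≤ C₂ (ϱ/τ)^4 A` and centres within `ϱ + R₂ τ` of `c`.  Stated for compactly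
supported `b` (guard inside; false for full-support profiles because of the support clause); used at `N = 6` (for `N = 0` the
error clause would lack the Lipschitz control of `f` it needs). [folklore] -/
def RiemannDisc (b : SchwartzMap E4 ℝ) (N : ℕ) : Prop :=
  HasCompactSupport (b : E4 → ℝ) → ∀ (J₀ : ℕ) (w : Fin J₀ → ℝ) (u : Fin J₀ → E4),
    ∃ C₂ R₂ : ℝ, 0 ≤ C₂ ∧ 0 ≤ R₂ ∧
      ∀ (f : E4 → ℝ) (c : E4) (ϱ σ A τ : ℝ), ContDiff ℝ ∞ f → 0 < τ → τ ≤ σ → σ ≤ ϱ → 0 ≤ A →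
        tsupport f ⊆ closedBall c ϱ →
        (∀ m : ℕ, m ≤ N → ∀ z, ‖iteratedFDeriv ℝ m f z‖ ≤ A / σ ^ m) →
        ∀ m₀ : ℕ, 1 ≤ m₀ →
          ∃ (J : ℕ) (a : Fin J → ℝ) (η : Fin J → E4),
            (∀ j, ‖η j - c‖ ≤ ϱ + R₂ * τ) ∧
            (∑ j, |a j| ≤ C₂ * (ϱ / τ) ^ 4 * A) ∧
            ContDiff ℝ ∞ (fun x => ∑ j, a j * b (τ⁻¹ • (x - η j))) ∧
            tsupport (fun x => ∑ j, a j * b (τ⁻¹ • (x - η j))) ⊆ closedBall c (ϱ + R₂ * τ) ∧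
            ∀ m : ℕ, m ≤ N → ∀ z,
              ‖iteratedFDeriv ℝ m (fun x => kSmooth (combKernel b w u) τ f x - ∑ j, a j * b (τ⁻¹ • (x - η j))) z‖ ≤
                C₂ / m₀ * A / τ ^ m

/-- **H4 composition (sorry-free).**  H1 at order 6, H4a and H4b give one round: `θ = min (1/2) (1/(2(C₁+1)))`,
`m₀ = ⌈2(C₂+1)/θ⁵⌉₊ + 1`, `C = C₂`, `R = R₂`. -/
theorem oneStepExists6_of_split (b : SchwartzMap E4 ℝ)
    (hM : HasCompactSupport (b : E4 → ℝ) → (∫ y, b y) ≠ 0 → MomentKilling b 6)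
    (hA : MolliApprox b 6) (hB : RiemannDisc b 6) :
    HasCompactSupport (b : E4 → ℝ) → (∫ y, b y) ≠ 0 →
      ∃ θ C R : ℝ, 0 < θ ∧ θ < 1 ∧ 0 ≤ C ∧ 0 ≤ R ∧ OneStep b 6 θ C R := by
  intro hb hI
  obtain ⟨J₀, lam, u, hint, hmom⟩ := hM hb hI
  set I : ℝ := ∫ y, b y with hIdef
  -- the normalised kernel weights
  set w : Fin J₀ → ℝ := fun j => I⁻¹ * lam j with hw
  have hK : ∀ v, combKernel b w u v = I⁻¹ * ∑ j, lam j * b (v - u j) := by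
    intro v; simp only [combKernel, hw, Finset.mul_sum, mul_assoc]
  have hK1 : (∫ y, combKernel b w u y) = 1 := by
    simp_rw [hK]
    rw [integral_const_mul, hint, hIdef, inv_mul_cancel₀ hI]
  have hKmom : ∀ α : Fin 4 → ℕ, 1 ≤ ∑ i, α i → ∑ i, α i < 6 →
      ∫ y, combKernel b w u y * ∏ i, (y i) ^ (α i) = 0 := by
    intro α h1 h2
    simp_rw [hK, mul_assoc]
    rw [integral_const_mul, hmom α h1 h2, mul_zero]
  obtain ⟨C₁, hC₁, hS1⟩ := hA hb J₀ w u hK1 hKmom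
  obtain ⟨C₂, R₂, hC₂, hR₂, hS2⟩ := hB hb J₀ w u
  -- the ratio and the oversampling
  set θ : ℝ := min (1 / 2) (1 / (2 * (C₁ + 1))) with hθdef
  have hθpos : 0 < θ := by rw [hθdef]; positivity
  have hθhalf : θ ≤ 1 / 2 := min_le_left _ _
  have hθ1 : θ < 1 := by linarith
  have hθC : C₁ * θ ≤ 1 / 2 := by
    have h1 : θ ≤ 1 / (2 * (C₁ + 1)) := min_le_right _ _
    have h2 : C₁ * θ ≤ C₁ * (1 / (2 * (C₁ + 1))) := mul_le_mul_of_nonneg_left h1 hC₁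
    have h3 : C₁ * (1 / (2 * (C₁ + 1))) ≤ 1 / 2 := by
      rw [mul_one_div, div_le_iff₀ (by positivity)]; nlinarith
    linarith
  set m₀ : ℕ := ⌈2 * (C₂ + 1) / θ ^ 5⌉₊ + 1 with hm₀def
  have hm₀1 : 1 ≤ m₀ := by rw [hm₀def]; omega
  have hm₀pos : (0 : ℝ) < m₀ := by exact_mod_cast hm₀1
  have hm₀C : C₂ / m₀ ≤ θ ^ 5 / 2 := by
    have hθ5 : 0 < θ ^ 5 := pow_pos hθpos 5
    have h1 : 2 * (C₂ + 1) / θ ^ 5 ≤ m₀ := by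
      rw [hm₀def]
      have := Nat.le_ceil (2 * (C₂ + 1) / θ ^ 5)
      push_cast
      linarith
    rw [div_le_iff₀ hm₀pos]
    rw [div_le_iff₀ hθ5] at h1
    nlinarith
  refine ⟨θ, C₂, R₂, hθpos, hθ1, hC₂, hR₂, ?_⟩
  intro f c ϱ σ A hf hσ hσϱ hA0 hsupp hbd
  have hτ : 0 < θ * σ := mul_pos hθpos hσ
  have hτσ : θ * σ ≤ σ := by nlinarith
  obtain ⟨hg, h1bd⟩ := hS1 f c ϱ σ A (θ * σ) hf hτ hτσ hσϱ hA0 hsupp hbd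
  obtain ⟨J, a, η, hη, hmass, hcd, hts, herr⟩ := hS2 f c ϱ σ A (θ * σ) hf hτ hτσ hσϱ hA0 hsupp hbd m₀ hm₀1
  refine ⟨J, a, η, hη, hmass, hf.sub hcd, ?_, ?_⟩
  · -- support of the residual
    refine closure_minimal ?_ isClosed_closedBall
    intro z hz
    rw [Function.mem_support] at hz
    by_cases hfz : f z = 0
    · have hSz : (fun x => ∑ j, a j * b ((θ * σ)⁻¹ • (x - η j))) z ≠ 0 := by
        intro h0; apply hz; simp only at h0; rw [hfz, h0, sub_zero]
      exact hts (subset_closure (Function.mem_support.2 hSz))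
    · have : z ∈ closedBall c ϱ := hsupp (subset_closure (Function.mem_support.2 hfz))
      rw [mem_closedBall] at this ⊢
      nlinarith [mul_nonneg hR₂ hτ.le]
  · -- the derivative bounds
    intro m hm z
    have hsplit : (fun x => f x - ∑ j, a j * b ((θ * σ)⁻¹ • (x - η j))) =
        (fun x => f x - kSmooth (combKernel b w u) (θ * σ) f x) +
        (fun x => kSmooth (combKernel b w u) (θ * σ) f x - ∑ j, a j * b ((θ * σ)⁻¹ • (x - η j))) := by
      funext x; simp only [Pi.add_apply]; ring
    have hm' : (m : WithTop ℕ∞) ≤ ∞ := by exact_mod_cast le_top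
    have hd1 : ContDiff ℝ m (fun x => f x - kSmooth (combKernel b w u) (θ * σ) f x) := (hf.sub hg).of_le hm'
    have hd2 : ContDiff ℝ m (fun x => kSmooth (combKernel b w u) (θ * σ) f x - ∑ j, a j * b ((θ * σ)⁻¹ • (x - η j))) :=
      (hg.sub hcd).of_le hm'
    rw [hsplit, iteratedFDeriv_add_apply hd1.contDiffAt hd2.contDiffAt]
    refine (norm_add_le _ _).trans ?_
    have e1 := h1bd m hm z
    have e2 := herr m hm z
    have hτm : 0 < (θ * σ) ^ m := pow_pos hτ m
    have hθσ : θ * σ / σ = θ := by field_simp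
    rw [hθσ] at e1
    -- `C₁ θ^6 A/τ^m + (C₂/m₀) A/τ^m ≤ θ^5 A/τ^m`
    have key : C₁ * θ ^ 6 * A / (θ * σ) ^ m + C₂ / m₀ * A / (θ * σ) ^ m ≤ θ ^ 5 * A / (θ * σ) ^ m := by
      rw [← add_div, div_le_div_iff_of_pos_right hτm]
      have h1 : C₁ * θ ^ 6 ≤ θ ^ 5 / 2 := by
        have : C₁ * θ ^ 6 = (C₁ * θ) * θ ^ 5 := by ring
        rw [this]; nlinarith [pow_pos hθpos 5]
      nlinarith
    linarith

/-- **Net reduction of the registered stub.** H1 (all profiles, order 6) + H4a + H4b ⇒ `stub_singleSlot`. -/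
theorem stubSingleSlot_of_split
    (hM : ∀ b : SchwartzMap E4 ℝ, HasCompactSupport (b : E4 → ℝ) → (∫ y, b y) ≠ 0 → MomentKilling b 6)
    (hA : ∀ b : SchwartzMap E4 ℝ, MolliApprox b 6) (hB : ∀ b : SchwartzMap E4 ℝ, RiemannDisc b 6) :
    Summit.QuantumFields.YangMills.Theorems.RPOnsetFloorPosTimeSynthCollar.StubSingleSlotP :=
  stubSingleSlot_of_oneStepExists 6 fun b hb hI =>
    oneStepExists6_of_split b (hM b) (hA b) (hB b) hb hI

end Summit.QuantumFields.YangMills.Cruxes.AtomicSynthesis.SingleSlotPlan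

end
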